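import Summits.NavierStokesRegularity.NavierStokesRegularity.Theorems.TargetDepletionLadderBoundedDivCurl
import Literature.Analysis.FluidPDE.HessianLpVector
import Literature.Analysis.FluidPDE.PineauVicolSliceEnstrophy
import HarnessLib

/-!
# Crux `Target` (stmt-NavierStokesRegularity-1217), line `depletion_ladder`, stub S1 (registered class):
# the Sobolev data `D¹u, D²u ∈ L²` of a BOUNDED field in the registered binders

`--supports stmt-NavierStokesRegularity-1217` (seat leafhand-ns-poloidalwindowdoor-3 g0, cell decomp-ns; step
(P3) of the registered-class programme for `stub_depletionBelowHalf`, after (P1) `…BoundedBiotSavart`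
and (P2) `…BoundedDivCurl` (this seat) and the `C¹` div–curl estimate `…C1DivCurl` (p817327)).

The binders of the registered `StretchingDepletion κ` are: `u ∈ C²(ℝ³; ℝ³)`, `div u = 0`, `‖u‖ ≤ M`,
`‖curl u‖² ∈ L¹`, `|∇ curl u|²_F ∈ L¹` (+ integrable stretching density). The tree's strain-cube chain
(`…StrainCubeDepletion`, `…StrainCubeSharpInterpolation`, `…StrainCubeIdentities`) consumes the
Sobolev data `h1 : ∫‖D¹v‖² < ∞`, `h2 : ∫‖D²v‖² < ∞` (operator norms of the iterated Fréchet
derivatives). This file derives exactly these from the registered binders, for bounded NON-decaying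
`u`:

* `integrable_sq_norm_fderiv_apply`, `integrable_frobeniusNormSq_fderiv_partial` — the partial
  derivative fields `Wₖ = ∂ₖu ∈ C¹` are divergence free, square integrable (`‖Wₖ‖² ≤ |Du|²_F ∈ L¹`
  by P2) with `curl Wₖ = ∂ₖ curl u ∈ L²`; hence (p817327) `|DWₖ|²_F ∈ L¹` and
  `∫ |DWₖ|²_F = ∫ ‖∂ₖ curl u‖²`; summed over `k`: `∑ₖ ∫ |D∂ₖu|²_F = ∫ |∇ curl u|²_F`
  (`sum_integral_frobeniusNormSq_fderiv_partial_eq`).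
* `lintegral_iteratedFDeriv_one_lt_top_of_bounded` — `h1`: `∫ ‖D¹u‖ₑ² ≤ ∫ |Du|²_F < ∞`
  (`‖L‖² ≤ |L|²_F`).
* `lintegral_iteratedFDeriv_two_lt_top_of_bounded` — `h2`: `‖D²u(x)‖ ≤ ∑ᵢⱼ ‖∂ⱼ∂ᵢu(x)‖`
  (`norm_iteratedFDeriv_two_le_sum`), so `‖D²u‖² ≤ 9 ∑ₖ |D∂ₖu|²_F` and `∫ ‖D²u‖ₑ² < ∞`.
* `registered_sobolev_data` — the package `(|Du|²_F ∈ L¹ ∧ ∫|Du|²_F = ∫‖ω‖²) ∧ h1 ∧ h2`.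

WHAT REMAINS for S1 as registered (census in this seat's NOTES): the chain lemmas are typed for
`v ∈ C^∞` with a bounded gradient; either re-run P4 (Betchov) / P5 (strain-cube integration by parts)
with cut-offs in `C²`, or mollify (`u_ε ∈ C^∞`, `‖u_ε‖ ≤ M`, `‖Du_ε‖ ≤ ‖ρ_ε‖₂‖Du‖₂`) and pass to the
limit in three `L²`/`L³` norms.

HONEST LABEL: helper (step P3 of an L/XL programme); closes no stub; no Navier–Stokes content;
`Target`, S3 and NS regularity remain OPEN.

References: G. P. Galdi (2011), §II.6; H. Sohr (2001), Lemma II.2.5.1. [folklore]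
-/

noncomputable section

-- the summit and its single sub-problem share the name (CONVENTIONS §1)
set_option linter.dupNamespace false

open MeasureTheory Set Function Filter Metric Real InnerProductSpace Topology
open scoped ENNReal NNReal RealInnerProductSpace
open Literature.Analysis.FluidPDE

namespace Summit.NavierStokesRegularity.NavierStokesRegularity.Theorems.DepletionLadder.BoundedSobolevData

open Summit.NavierStokesRegularity.NavierStokesRegularity.Theorems.DepletionLadder.BoundedDivCurl
open Summit.NavierStokesRegularity.NavierStokesRegularity.Theorems.DepletionLadder.C1DivCurl

variable {u : (EuclideanSpace ℝ (Fin 3)) → (EuclideanSpace ℝ (Fin 3))}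

/-! ### The partial-derivative fields `Wₖ = ∂ₖu` -/

/-- `∂ₖu ∈ C¹` for `u ∈ C²`. [folklore] -/
theorem contDiff_one_fderiv_apply (hu : ContDiff ℝ 2 u) (e : EuclideanSpace ℝ (Fin 3)) :
    ContDiff ℝ 1 (fun y => fderiv ℝ u y e) :=
  (hu.fderiv_right (m := 1) (by norm_num)).clm_apply contDiff_const

/-- **`∂ₖu ∈ L²`** once `|Du|²_F ∈ L¹` (`‖∂ₖu‖² ≤ |Du|²_F`). [folklore] -/
theorem integrable_sq_norm_fderiv_apply (hu : ContDiff ℝ 2 u)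
    (hD : Integrable fun x => frobeniusNormSq (fderiv ℝ u x)) (k : Fin 3) :
    Integrable fun x => ‖fderiv ℝ u x (EuclideanSpace.basisFun (Fin 3) ℝ k)‖ ^ 2 := by
  have hc : Continuous fun x => ‖fderiv ℝ u x (EuclideanSpace.basisFun (Fin 3) ℝ k)‖ ^ 2 :=
    ((contDiff_one_fderiv_apply hu _).continuous.norm).pow 2
  refine hD.mono' hc.aestronglyMeasurable (Eventually.of_forall fun x => ?_)
  rw [Real.norm_of_nonneg (sq_nonneg _)]
  exact sq_norm_apply_basisFun_le_frobeniusNormSq _ k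

/-- **`curl ∂ₖu = ∂ₖ curl u ∈ L²`** once `|∇ curl u|²_F ∈ L¹`. [folklore] -/
theorem integrable_sq_norm_curl_fderiv_apply (hu : ContDiff ℝ 2 u)
    (hP : Integrable fun x => frobeniusNormSq (fderiv ℝ (curl u) x)) (k : Fin 3) :
    Integrable fun x => ‖curl (fun y => fderiv ℝ u y (EuclideanSpace.basisFun (Fin 3) ℝ k)) x‖ ^ 2 := by
  have hcurl : (fun x => ‖curl (fun y => fderiv ℝ u y (EuclideanSpace.basisFun (Fin 3) ℝ k)) x‖ ^ 2) =
      fun x => ‖fderiv ℝ (curl u) x (EuclideanSpace.basisFun (Fin 3) ℝ k)‖ ^ 2 := by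
    funext x; rw [curl_fderiv_apply hu x]
  rw [hcurl]
  have hω1 : ContDiff ℝ 1 (curl u) := contDiff_one_curl_of_contDiff_two hu
  have hc : Continuous fun x => ‖fderiv ℝ (curl u) x (EuclideanSpace.basisFun (Fin 3) ℝ k)‖ ^ 2 :=
    (((hω1.continuous_fderiv one_ne_zero).clm_apply continuous_const).norm).pow 2
  refine hP.mono' hc.aestronglyMeasurable (Eventually.of_forall fun x => ?_)
  rw [Real.norm_of_nonneg (sq_nonneg _)]
  exact sq_norm_apply_basisFun_le_frobeniusNormSq _ k

/-- **`|D∂ₖu|²_F ∈ L¹` with `∫ |D∂ₖu|²_F = ∫ ‖∂ₖ curl u‖²`** for `u` in the registered binders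
(`u ∈ C²`, `div u = 0`, `‖u‖ ≤ M`, `‖curl u‖² ∈ L¹`, `|∇ curl u|²_F ∈ L¹`): `Wₖ = ∂ₖu ∈ C¹` is
divergence free, in `L²` by P2, with `curl Wₖ = ∂ₖ curl u ∈ L²`, so the `C¹` div–curl estimate and
identity (p817327) apply. [folklore] -/
theorem integrable_frobeniusNormSq_fderiv_partial (hu : ContDiff ℝ 2 u)
    (hdiv : VectorCalculus.IsDivFree u) {M : ℝ} (hM : ∀ x, ‖u x‖ ≤ M)
    (hZ : Integrable fun x => ‖curl u x‖ ^ 2)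
    (hP : Integrable fun x => frobeniusNormSq (fderiv ℝ (curl u) x)) (k : Fin 3) :
    Integrable (fun x => frobeniusNormSq
        (fderiv ℝ (fun y => fderiv ℝ u y (EuclideanSpace.basisFun (Fin 3) ℝ k)) x)) ∧
      ∫ x, frobeniusNormSq (fderiv ℝ (fun y => fderiv ℝ u y (EuclideanSpace.basisFun (Fin 3) ℝ k)) x) =
        ∫ x, ‖fderiv ℝ (curl u) x (EuclideanSpace.basisFun (Fin 3) ℝ k)‖ ^ 2 := by
  have hW : ContDiff ℝ 1 (fun y => fderiv ℝ u y (EuclideanSpace.basisFun (Fin 3) ℝ k)) :=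
    contDiff_one_fderiv_apply hu _
  have hWdiv : VectorCalculus.IsDivFree (fun y => fderiv ℝ u y (EuclideanSpace.basisFun (Fin 3) ℝ k)) :=
    VectorCalculus.IsDivFree.fderiv_apply hu hdiv _
  have hD : Integrable fun x => frobeniusNormSq (fderiv ℝ u x) :=
    integrable_frobeniusNormSq_fderiv_of_bounded hu hdiv hM hZ
  have hWL2 := integrable_sq_norm_fderiv_apply hu hD k
  have hWC := integrable_sq_norm_curl_fderiv_apply hu hP k
  refine ⟨integrable_frobeniusNormSq_fderiv_of_contDiff_one hW hWdiv hWL2 hWC, ?_⟩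
  rw [integral_frobeniusNormSq_fderiv_eq_of_contDiff_one hW hWdiv hWL2 hWC]
  refine integral_congr_ae (Eventually.of_forall fun x => ?_)
  show ‖curl (fun y => fderiv ℝ u y (EuclideanSpace.basisFun (Fin 3) ℝ k)) x‖ ^ 2 =
    ‖fderiv ℝ (curl u) x (EuclideanSpace.basisFun (Fin 3) ℝ k)‖ ^ 2
  rw [curl_fderiv_apply hu x]

/-- **`∑ₖ ∫ |D∂ₖu|²_F = ∫ |∇ curl u|²_F`** in the registered binders: the full Hessian of a bounded
divergence-free field is controlled by the palinstrophy, with constant one. [folklore] -/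
theorem sum_integral_frobeniusNormSq_fderiv_partial_eq (hu : ContDiff ℝ 2 u)
    (hdiv : VectorCalculus.IsDivFree u) {M : ℝ} (hM : ∀ x, ‖u x‖ ≤ M)
    (hZ : Integrable fun x => ‖curl u x‖ ^ 2)
    (hP : Integrable fun x => frobeniusNormSq (fderiv ℝ (curl u) x)) :
    ∑ k, ∫ x, frobeniusNormSq (fderiv ℝ (fun y => fderiv ℝ u y (EuclideanSpace.basisFun (Fin 3) ℝ k)) x) =
      ∫ x, frobeniusNormSq (fderiv ℝ (curl u) x) := by
  have hk := fun k => integrable_frobeniusNormSq_fderiv_partial hu hdiv hM hZ hP k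
  have hω1 : ContDiff ℝ 1 (curl u) := contDiff_one_curl_of_contDiff_two hu
  have hi : ∀ k : Fin 3, Integrable fun x => ‖fderiv ℝ (curl u) x (EuclideanSpace.basisFun (Fin 3) ℝ k)‖ ^ 2 := by
    intro k
    have h := integrable_sq_norm_curl_fderiv_apply hu hP k
    refine h.congr (Eventually.of_forall fun x => ?_)
    show ‖curl (fun y => fderiv ℝ u y (EuclideanSpace.basisFun (Fin 3) ℝ k)) x‖ ^ 2 = _
    rw [curl_fderiv_apply hu x]
  calc ∑ k, ∫ x, frobeniusNormSq (fderiv ℝ (fun y => fderiv ℝ u y (EuclideanSpace.basisFun (Fin 3) ℝ k)) x)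
      = ∑ k, ∫ x, ‖fderiv ℝ (curl u) x (EuclideanSpace.basisFun (Fin 3) ℝ k)‖ ^ 2 :=
        Finset.sum_congr rfl fun k _ => (hk k).2
    _ = ∫ x, ∑ k, ‖fderiv ℝ (curl u) x (EuclideanSpace.basisFun (Fin 3) ℝ k)‖ ^ 2 :=
        (integral_finsetSum _ fun k _ => hi k).symm
    _ = ∫ x, frobeniusNormSq (fderiv ℝ (curl u) x) :=
        integral_congr_ae (Eventually.of_forall fun x =>
          (frobeniusNormSq_eq_sum (EuclideanSpace.basisFun (Fin 3) ℝ) _).symm)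

/-! ### The Sobolev data `h1`, `h2` of the strain-cube chain -/

/-- `‖D¹u(x)‖ = ‖Du(x)‖`. [folklore] -/
theorem norm_iteratedFDeriv_one_eq (x : EuclideanSpace ℝ (Fin 3)) :
    ‖iteratedFDeriv ℝ 1 u x‖ = ‖fderiv ℝ u x‖ := by
  rw [← norm_iteratedFDeriv_fderiv, norm_iteratedFDeriv_zero]

/-- A continuous nonnegative real function with integrable majorant has finite lower integral: if
`0 ≤ f ≤ g` pointwise and `g ∈ L¹` then `∫⁻ ofReal f < ∞`. [folklore] -/
theorem lintegral_ofReal_lt_top_of_le {f g : EuclideanSpace ℝ (Fin 3) → ℝ} (hg : Integrable g)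
    (hfg : ∀ x, f x ≤ g x) : ∫⁻ x, ENNReal.ofReal (f x) < ⊤ := by
  have h := hg.hasFiniteIntegral
  rw [hasFiniteIntegral_iff_enorm] at h
  refine lt_of_le_of_lt (lintegral_mono fun x => ?_) h
  rw [Real.enorm_eq_ofReal_abs]
  exact ENNReal.ofReal_le_ofReal ((hfg x).trans (le_abs_self _))

/-- **`h1`: `∫ ‖D¹u‖ₑ² < ∞`** in the registered binders (`‖Du‖² ≤ |Du|²_F ∈ L¹` by P2). [folklore] -/
theorem lintegral_iteratedFDeriv_one_lt_top_of_bounded (hu : ContDiff ℝ 2 u)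
    (hdiv : VectorCalculus.IsDivFree u) {M : ℝ} (hM : ∀ x, ‖u x‖ ≤ M)
    (hZ : Integrable fun x => ‖curl u x‖ ^ 2) :
    ∫⁻ x, ‖iteratedFDeriv ℝ 1 u x‖ₑ ^ 2 < ⊤ := by
  have hD : Integrable fun x => frobeniusNormSq (fderiv ℝ u x) :=
    integrable_frobeniusNormSq_fderiv_of_bounded hu hdiv hM hZ
  have heq : ∀ x, (‖iteratedFDeriv ℝ 1 u x‖ₑ : ℝ≥0∞) ^ 2 = ENNReal.ofReal (‖fderiv ℝ u x‖ ^ 2) := by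
    intro x
    rw [← ofReal_norm, norm_iteratedFDeriv_one_eq, ENNReal.ofReal_pow (norm_nonneg _)]
  simp_rw [heq]
  exact lintegral_ofReal_lt_top_of_le hD fun x => sq_opNorm_le_frobeniusNormSq _

/-- `(∑ᵢⱼ aᵢⱼ)² ≤ 9 ∑ᵢⱼ aᵢⱼ²` over `Fin 3 × Fin 3` (Cauchy–Schwarz). [folklore] -/
theorem sq_sum_sum_le_nine_mul (a : Fin 3 → Fin 3 → ℝ) :
    (∑ i, ∑ j, a i j) ^ 2 ≤ 9 * ∑ i, ∑ j, a i j ^ 2 := by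
  have h1 : (∑ i, ∑ j, a i j) ^ 2 ≤ 3 * ∑ i, (∑ j, a i j) ^ 2 := by
    have h := sq_sum_le_card_mul_sum_sq (s := (Finset.univ : Finset (Fin 3))) (f := fun i => ∑ j, a i j)
    simpa using h
  have h2 : ∀ i, (∑ j, a i j) ^ 2 ≤ 3 * ∑ j, a i j ^ 2 := by
    intro i
    have h := sq_sum_le_card_mul_sum_sq (s := (Finset.univ : Finset (Fin 3))) (f := fun j => a i j)
    simpa using h
  calc (∑ i, ∑ j, a i j) ^ 2 ≤ 3 * ∑ i, (∑ j, a i j) ^ 2 := h1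
    _ ≤ 3 * ∑ i, (3 * ∑ j, a i j ^ 2) := by
        gcongr with i _
        exact h2 i
    _ = 9 * ∑ i, ∑ j, a i j ^ 2 := by rw [← Finset.mul_sum]; ring

/-- **Pointwise: `‖D²u(x)‖² ≤ 9 ∑ₖ |D∂ₖu(x)|²_F`** (`‖D²u(x)‖ ≤ ∑ᵢⱼ ‖∂ⱼ∂ᵢu(x)‖`,
`norm_iteratedFDeriv_two_le_sum`, and Cauchy–Schwarz). [folklore] -/
theorem norm_iteratedFDeriv_two_sq_le (hu : ContDiff ℝ 2 u) (x : EuclideanSpace ℝ (Fin 3)) :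
    ‖iteratedFDeriv ℝ 2 u x‖ ^ 2 ≤
      9 * ∑ i, frobeniusNormSq
        (fderiv ℝ (fun y => fderiv ℝ u y (EuclideanSpace.basisFun (Fin 3) ℝ i)) x) := by
  set a : Fin 3 → Fin 3 → ℝ := fun i j =>
    ‖fderiv ℝ (fun y => fderiv ℝ u y (EuclideanSpace.basisFun (Fin 3) ℝ i)) x
      (EuclideanSpace.basisFun (Fin 3) ℝ j)‖ with ha
  have hle : ‖iteratedFDeriv ℝ 2 u x‖ ≤ ∑ i, ∑ j, a i j :=
    norm_iteratedFDeriv_two_le_sum (EuclideanSpace.basisFun (Fin 3) ℝ) hu x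
  have h0 : 0 ≤ ∑ i, ∑ j, a i j :=
    Finset.sum_nonneg fun i _ => Finset.sum_nonneg fun j _ => norm_nonneg _
  have hF : ∀ i, frobeniusNormSq
      (fderiv ℝ (fun y => fderiv ℝ u y (EuclideanSpace.basisFun (Fin 3) ℝ i)) x) = ∑ j, a i j ^ 2 :=
    fun i => frobeniusNormSq_eq_sum (EuclideanSpace.basisFun (Fin 3) ℝ) _
  calc ‖iteratedFDeriv ℝ 2 u x‖ ^ 2 ≤ (∑ i, ∑ j, a i j) ^ 2 :=
        pow_le_pow_left₀ (norm_nonneg _) hle 2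
    _ ≤ 9 * ∑ i, ∑ j, a i j ^ 2 := sq_sum_sum_le_nine_mul a
    _ = 9 * ∑ i, frobeniusNormSq
          (fderiv ℝ (fun y => fderiv ℝ u y (EuclideanSpace.basisFun (Fin 3) ℝ i)) x) := by
        simp_rw [hF]

/-- **`h2`: `∫ ‖D²u‖ₑ² < ∞`** in the registered binders. [folklore] -/
theorem lintegral_iteratedFDeriv_two_lt_top_of_bounded (hu : ContDiff ℝ 2 u)
    (hdiv : VectorCalculus.IsDivFree u) {M : ℝ} (hM : ∀ x, ‖u x‖ ≤ M)
    (hZ : Integrable fun x => ‖curl u x‖ ^ 2)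
    (hP : Integrable fun x => frobeniusNormSq (fderiv ℝ (curl u) x)) :
    ∫⁻ x, ‖iteratedFDeriv ℝ 2 u x‖ₑ ^ 2 < ⊤ := by
  have hk := fun k => (integrable_frobeniusNormSq_fderiv_partial hu hdiv hM hZ hP k).1
  have hg : Integrable fun x => 9 * ∑ i, frobeniusNormSq
      (fderiv ℝ (fun y => fderiv ℝ u y (EuclideanSpace.basisFun (Fin 3) ℝ i)) x) :=
    (integrable_finsetSum _ fun i _ => hk i).const_mul 9
  have heq : ∀ x, (‖iteratedFDeriv ℝ 2 u x‖ₑ : ℝ≥0∞) ^ 2 =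
      ENNReal.ofReal (‖iteratedFDeriv ℝ 2 u x‖ ^ 2) := by
    intro x
    rw [← ofReal_norm, ENNReal.ofReal_pow (norm_nonneg _)]
  simp_rw [heq]
  refine lintegral_ofReal_lt_top_of_le hg fun x => ?_
  have h := norm_iteratedFDeriv_two_sq_le hu x
  simpa only [Finset.sum_apply] using h

/-- ★ **Registered-class Sobolev data.** For `u ∈ C²(ℝ³; ℝ³)` divergence free with `‖u‖ ≤ M`,
`‖curl u‖² ∈ L¹` and `|∇ curl u|²_F ∈ L¹` (the binders of `StretchingDepletion`):
`|Du|²_F ∈ L¹` with `∫|Du|²_F = ∫‖curl u‖²`, `∫‖D¹u‖ₑ² < ∞` and `∫‖D²u‖ₑ² < ∞` — the hypotheses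
`h1`, `h2` of the tree's strain-cube chain, earned for bounded non-decaying fields. [folklore] -/
theorem registered_sobolev_data (hu : ContDiff ℝ 2 u)
    (hdiv : VectorCalculus.IsDivFree u) {M : ℝ} (hM : ∀ x, ‖u x‖ ≤ M)
    (hZ : Integrable fun x => ‖curl u x‖ ^ 2)
    (hP : Integrable fun x => frobeniusNormSq (fderiv ℝ (curl u) x)) :
    (Integrable (fun x => frobeniusNormSq (fderiv ℝ u x)) ∧
        ∫ x, frobeniusNormSq (fderiv ℝ u x) = ∫ x, ‖curl u x‖ ^ 2) ∧
      ∫⁻ x, ‖iteratedFDeriv ℝ 1 u x‖ₑ ^ 2 < ⊤ ∧ ∫⁻ x, ‖iteratedFDeriv ℝ 2 u x‖ₑ ^ 2 < ⊤ :=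
  ⟨registered_gradient_sq_integrable_and_eq hu hdiv hM hZ,
    lintegral_iteratedFDeriv_one_lt_top_of_bounded hu hdiv hM hZ,
    lintegral_iteratedFDeriv_two_lt_top_of_bounded hu hdiv hM hZ hP⟩

end Summit.NavierStokesRegularity.NavierStokesRegularity.Theorems.DepletionLadder.BoundedSobolevData

end
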